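import Mathlib

/-!
# Kernel certificate for the D₄ triple of CM surfaces (P2-ProductsOfSurfaces.md)

Points `0..11` = Hom(K₀,ℂ) ⊔ Hom(K₀,ℂ) ⊔ Hom(K₂,ℂ); `ι` = complex conjugation; `T = ⟨a, b⟩ ≅ D₄` is listed
explicitly; `Φ = {0,1,4,7,8,9}` is the CM type of `C₀ × C₁ × C₂`; `S = {0,6,8,11}`.
Certified (by `decide`): `T` is closed under composition, contains `a`, `b`, `ι` (so `T = ⟨a,b⟩`), `ι` is central;
every `t·Φ` is an `ι`-transversal; `S` is balanced (`|S ∩ tΦ| = 2` for all `t ∈ T`); the balanced 2-sets are exactly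
the six `ι`-pairs; `S` is not a union of two balanced 2-sets (an exceptional Hodge set by Pohlmann's criterion);
its `T`-orbit has exactly 4 elements (orbit field of degree 4).
-/

namespace HodgeRepro0.D4Triple

/-- apply a permutation given as a list of images -/
def ap (p : List Nat) (i : Nat) : Nat := p.getD i 0

/-- composition `p ∘ q` -/
def comp (p q : List Nat) : List Nat := (List.range 12).map fun i => ap p (ap q i)

/-- the reflection `a` of `D₄`: `(0 2)` on the first `K₀`-block, `(4 6)` on the second, `(8 9)(10 11)` on the `K₂`-block -/
def a : List Nat := [2,1,0,3, 6,5,4,7, 9,8,11,10]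
/-- the reflection `b` of `D₄`: `(0 1)(2 3)`, `(4 5)(6 7)`, `(8 10)` -/
def b : List Nat := [1,0,3,2, 5,4,7,6, 10,9,8,11]
/-- the identity permutation -/
def e : List Nat := List.range 12
/-- the 4-cycle `ab` -/
def ab : List Nat := comp a b
/-- complex conjugation `ι = (ab)²` -/
def iota : List Nat := comp ab ab

/-- the eight elements of `T = D₄` -/
def T : List (List Nat) := [e, a, b, ab, comp b a, iota, comp a iota, comp b iota]

/-- the CM type `Φ₀ ⊔ Φ₁ ⊔ Φ₂ = {0,1} ⊔ {4,7} ⊔ {8,9}` -/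
def Phi : List Nat := [0,1,4,7,8,9]
/-- the candidate exceptional Hodge set -/
def S : List Nat := [0,6,8,11]

/-- image of a set under a permutation -/
def image (t : List Nat) (X : List Nat) : List Nat := X.map (ap t)
/-- intersection of two lists regarded as sets -/
def inter (X Y : List Nat) : List Nat := X.filter (fun x => Y.contains x)
/-- `|X ∩ t·Φ| = p` -/
def balancedAt (X : List Nat) (p : Nat) (t : List Nat) : Bool := (inter X (image t Phi)).length == p
/-- Pohlmann's balance condition for all `t ∈ T` -/
def balanced (X : List Nat) (p : Nat) : Bool := T.all (balancedAt X p)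

/-- all 2-element subsets of `0..11` -/
def pairs : List (List Nat) :=
  ((List.range 12).flatMap fun i => (List.range 12).filterMap fun j => if i < j then some [i, j] else none)

/-- the six `ι`-pairs -/
def iotaPairs : List (List Nat) := [[0,2],[1,3],[4,6],[5,7],[8,10],[9,11]]

/-- equality of lists as sets -/
def sameSet (X Y : List Nat) : Bool := X.all Y.contains && Y.all X.contains

/-- representatives of the distinct images `t·S`, `t ∈ T` (the Galois orbit of `S`) -/
def orbitS : List (List Nat) :=
  T.foldl (fun acc t => let Y := image t S; if acc.any (sameSet Y) then acc else acc ++ [Y]) []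

/-- `T` is closed under composition -/
theorem T_closed : (T.all fun s => T.all fun t => T.contains (comp s t)) = true := by decide
/-- `T` contains `a`, `b`, `ι` -/
theorem T_contains_gens : (T.contains a && T.contains b && T.contains iota) = true := by decide
/-- `ι` is central in `T` -/
theorem iota_central : (T.all fun t => comp iota t == comp t iota) = true := by decide
/-- `ι² = e` -/
theorem iota_involution : (comp iota iota == e) = true := by decide
/-- every translate `t·Φ` contains exactly one point of each `ι`-pair -/
theorem types_transversal :
    (T.all fun t => (List.range 12).all fun x => ((image t Phi).contains x) != ((image t Phi).contains (ap iota x))) = true := by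
  decide
/-- `S` is balanced: `|S ∩ t·Φ| = 2` for all `t ∈ T` -/
theorem S_balanced : balanced S 2 = true := by decide
/-- the balanced 2-sets are exactly the `ι`-pairs -/
theorem hodge_pairs_are_iota_pairs :
    (pairs.filter fun P => balanced P 1) = iotaPairs := by decide
/-- `S` contains no `ι`-pair, hence is not a union of balanced 2-sets: exceptional -/
theorem S_not_pair_decomposable :
    (iotaPairs.all fun P => !(P.all S.contains)) = true := by decide
/-- the `T`-orbit of `S` has 4 elements -/
theorem orbit_size : orbitS.length = 4 := by decide

/-- the certificate, as one statement -/
theorem certificate :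
    (T.all fun s => T.all fun t => T.contains (comp s t)) = true ∧
    (T.contains a && T.contains b && T.contains iota) = true ∧
    (T.all fun t => comp iota t == comp t iota) = true ∧
    balanced S 2 = true ∧
    (pairs.filter fun P => balanced P 1) = iotaPairs ∧
    (iotaPairs.all fun P => !(P.all S.contains)) = true ∧
    orbitS.length = 4 :=
  ⟨T_closed, T_contains_gens, iota_central, S_balanced, hodge_pairs_are_iota_pairs, S_not_pair_decomposable, orbit_size⟩

end HodgeRepro0.D4Triple
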